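import Summits.ResolutionOfSingularities.ResolutionOfSingularities.Theorems.PurelyInseparableDim4PointZigzagStep
import HarnessLib

/-!
# Purely inseparable four-folds: POINT TRANSPORT — the closed order-`p` points over a blown-up point of ANY ambient inject
# into those of the MODEL blow-up of `𝔸⁵_K` at the origin (brick TY-3k part 5a, cell `res-dim4-pi`)

[OURS · counted 0] (D-0157 DOOR 2; finite-tree assembly of `PIDim4.TerminationImpliesOrderReduction`, MODE 0, isolated regime;
host item stmt-ResolutionOfSingularities-16155, helper). Resolution of singularities in dimension ≥ 4 / characteristic `p`
is NOT proved here or anywhere in this programme.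

Under the ZIGZAG INVARIANT at `(Z, M, x₀)` (`…PointZigzagStep`: open immersions `φ : Y ⟶ Z`, `ψ : Y ⟶ 𝔸⁵_K`, `φ y = x₀`,
`ψ y = ξ`, `M.ideal.comap φ = (hypSheaf p s.F).comap ψ`, `mult M = p`) and for ANY blowing up `π : W → Z` of `x₀`, the
isomorphism `ε : π⁻¹(φ Y) ≅ B⁻¹(ψ Y)` over `Y` with the chosen blowing up `B : Bl → 𝔸⁵_K` of the origin
(`IsBlowup.unique`) is made reusable:

* **`exists_pointTransport_of_zigzag`** — an INJECTIVE map `{w ∈ W over x₀} → Bl` landing over `ξ`, carrying closed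
  points to closed points and preserving the order of the transformed ideals;
* **`finite_closedOver_of_zigzag`** — ONE-STEP FINITENESS of the MODEL at `s` (finitely many closed order-`p` points of
  the `B`-transform of `(z^p + s.F)·𝒪` over the origin) ⇒ finitely many closed order-`p` points of `M.transform π 𝓘_{x₀}`
  over `x₀`.

Part 5b (`…PointTreeLocal`) runs the finite-tree induction on this walk-local hypothesis. AI-produced formalisation,
weaker than expert review. bears_on: LADDER-RESOLUTION:D157-DOOR2 (res-dim4-pi · TY-3k).
-/

set_option linter.dupNamespace false -- D-0017: single-problem summit path `Summit.<S>.<S>.…` by design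

noncomputable section

open MvPolynomial Finset CategoryTheory AlgebraicGeometry Opposite TopologicalSpace

namespace Summit.ResolutionOfSingularities.ResolutionOfSingularities.Theorems.PIDim4

open Literature.AlgebraicGeometry.Resolution
open Literature.AlgebraicGeometry.Resolution.Hauser2010
open Literature.AlgebraicGeometry.Resolution.AffinePointBlowup (P A γ coord Wtop ξ)

namespace Equimultiple

/-! ## The point transport along `ε : π⁻¹(φ Y) ≅ B⁻¹(ψ Y)` -/

section Transport

variable {K : Type} [Field K] {p : ℕ}
variable {Z W Y : Scheme.{0}} {π : W ⟶ Z} {x₀ : Z}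

/-- **POINT TRANSPORT.** Under the ZIGZAG INVARIANT at `(Z, M, x₀)` (`…PointZigzagStep`) and for ANY blowing up
`π : W → Z` of `x₀`, with `B : Bl → 𝔸⁵_K` the chosen blowing up of the origin: there is an INJECTIVE map `f` from the
points of `W` over `x₀` to `Bl`, landing over `ξ`, carrying closed points to closed points, and preserving the order of
the transformed ideals: `ord_{f w} Bᶜ((z^p + s.F)·𝒪, p) = ord_w (M.transform π 𝓘_{x₀}).ideal` (the isomorphism
`π⁻¹(φ Y) ≅ B⁻¹(ψ Y)` over `Y` of `IsBlowup.unique`, and flat base change of controlled transforms).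
[cite: GortzWedhorn2020, Prop. 13.91] [cite: BierstoneGrigorievMilmanWlodarczyk2011, §3.2 with Thm. 8.0.5] -/
theorem exists_pointTransport_of_zigzag [IsLocallyNoetherian Z] (φ : Y ⟶ Z) [IsOpenImmersion φ] (ψ : Y ⟶ P 4 K)
    [IsOpenImmersion ψ] (y : Y) (hx₀ : IsClosed ({x₀} : Set Z)) (hφ : φ y = x₀) (hψ : ψ y = ξ 4 K)
    (M : MarkedIdeal Z) (hmult : M.mult = p) (s : State K) (hM : M.ideal.comap φ = (hypSheaf p s.F).comap ψ)
    (hπ : IsBlowup π (Scheme.IdealSheafData.vanishingIdeal (⟨{x₀}, hx₀⟩ : Closeds Z))) :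
    ∃ f : {w : W // π w = x₀} →
        blowup (Scheme.IdealSheafData.vanishingIdeal (AffinePointBlowup.C₀ 4 K)),
      Function.Injective f ∧ ∀ w,
        blowup.π (Scheme.IdealSheafData.vanishingIdeal (AffinePointBlowup.C₀ 4 K)) (f w) = ξ 4 K ∧
        (IsClosed ({w.1} : Set W) → IsClosed ({f w} : Set (blowup
          (Scheme.IdealSheafData.vanishingIdeal (AffinePointBlowup.C₀ 4 K))))) ∧
        idealOrder ((⟨hypSheaf p s.F, [], p⟩ : MarkedIdeal (P 4 K)).transform
            (blowup.π (Scheme.IdealSheafData.vanishingIdeal (AffinePointBlowup.C₀ 4 K)))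
            (Scheme.IdealSheafData.vanishingIdeal (AffinePointBlowup.C₀ 4 K))).ideal (f w) =
          idealOrder (M.transform π (Scheme.IdealSheafData.vanishingIdeal (⟨{x₀}, hx₀⟩ : Closeds Z))).ideal w.1 := by
  haveI : IsProper π := hπ.isProper
  haveI : IsLocallyNoetherian W := LocallyOfFiniteType.isLocallyNoetherian π
  set C := Scheme.IdealSheafData.vanishingIdeal (⟨{x₀}, hx₀⟩ : Closeds Z) with hC
  have hξc : IsClosed ({ξ 4 K} : Set (P 4 K)) := AffinePointBlowup.isClosed_ξ 4 K
  have hC₀' : AffinePointBlowup.C₀ 4 K = (⟨{ξ 4 K}, hξc⟩ : Closeds (P 4 K)) := rfl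
  rw [hC₀']
  set C₀ := Scheme.IdealSheafData.vanishingIdeal (⟨{ξ 4 K}, hξc⟩ : Closeds (P 4 K)) with hC₀
  set B := blowup.π C₀ with hBdef
  have hB : IsBlowup B C₀ := blowup.isBlowup C₀
  haveI : IsProper B := hB.isProper
  haveI : IsLocallyNoetherian (blowup C₀) := LocallyOfFiniteType.isLocallyNoetherian B
  haveI : JacobsonSpace (blowup C₀) := jacobsonSpace_of_isBlowup' hB
  set M₀ : MarkedIdeal (P 4 K) := ⟨hypSheaf p s.F, [], p⟩ with hM₀
  have hy : IsClosed ({y} : Set Y) := isClosed_singleton_of_isOpenImmersion_eq φ y hx₀ hφ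
  set Cy := Scheme.IdealSheafData.vanishingIdeal (⟨{y}, hy⟩ : Closeds Y) with hCy
  set V : Z.Opens := φ.opensRange with hV
  set U : (P 4 K).Opens := ψ.opensRange with hU
  set e₁ : Y ≅ (V : Scheme.{0}) := φ.isoOpensRange with he₁
  set e₂ : Y ≅ (U : Scheme.{0}) := ψ.isoOpensRange with he₂
  have he₁ι : e₁.hom ≫ V.ι = φ := Scheme.Hom.isoOpensRange_hom_ι φ
  have he₂ι : e₂.hom ≫ U.ι = ψ := Scheme.Hom.isoOpensRange_hom_ι ψ
  have hCV : (C.comap V.ι).comap e₁.hom = Cy := by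
    rw [← Scheme.IdealSheafData.comap_comp, he₁ι]
    exact comap_vanishingIdeal_singleton_of_isOpenImmersion φ y hx₀ hφ hy
  have hCU : (C₀.comap U.ι).comap e₂.hom = Cy := by
    rw [← Scheme.IdealSheafData.comap_comp, he₂ι]
    exact comap_vanishingIdeal_singleton_of_isOpenImmersion ψ y hξc hψ hy
  have hIV : (M.ideal.comap V.ι).comap e₁.hom = (hypSheaf p s.F).comap ψ := by
    rw [← Scheme.IdealSheafData.comap_comp, he₁ι]
    exact hM
  have hIU : (M₀.ideal.comap U.ι).comap e₂.hom = (hypSheaf p s.F).comap ψ := by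
    rw [← Scheme.IdealSheafData.comap_comp, he₂ι]
  -- the two restricted blow-ups are blow-ups of `Y` at `y`, isomorphic over `Y`
  have hπY : IsBlowup ((π ∣_ V) ≫ e₁.inv) Cy := isBlowup_restrict_comp_isoOpensRange_inv φ y hx₀ hφ hy hπ
  have hBY : IsBlowup ((B ∣_ U) ≫ e₂.inv) Cy := isBlowup_restrict_comp_isoOpensRange_inv ψ y hξc hψ hy hB
  obtain ⟨ε, hε, -⟩ := hπY.unique hBY
  have hsq : ε.hom ≫ (B ∣_ U) = (π ∣_ V) ≫ (e₁.inv ≫ e₂.hom) := by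
    calc ε.hom ≫ (B ∣_ U) = (ε.hom ≫ ((B ∣_ U) ≫ e₂.inv)) ≫ e₂.hom := by
          simp only [Category.assoc, Iso.inv_hom_id, Category.comp_id]
      _ = ((π ∣_ V) ≫ e₁.inv) ≫ e₂.hom := by rw [hε]
      _ = (π ∣_ V) ≫ (e₁.inv ≫ e₂.hom) := by simp only [Category.assoc]
  have hC' : (C₀.comap U.ι).comap (e₁.inv ≫ e₂.hom) = C.comap V.ι := by
    rw [Scheme.IdealSheafData.comap_comp, hCU, ← hCV, ← Scheme.IdealSheafData.comap_comp, Iso.inv_hom_id,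
      Scheme.IdealSheafData.comap_id]
  have hI' : (M₀.ideal.comap U.ι).comap (e₁.inv ≫ e₂.hom) = M.ideal.comap V.ι := by
    rw [Scheme.IdealSheafData.comap_comp, hIU, ← hIV, ← Scheme.IdealSheafData.comap_comp, Iso.inv_hom_id,
      Scheme.IdealSheafData.comap_id]
  have hKEY : ((M₀.transform B C₀).ideal.comap (B ⁻¹ᵁ U).ι).comap ε.hom =
      (M.transform π C).ideal.comap (π ⁻¹ᵁ V).ι := by
    rw [MarkedIdeal.transform_ideal, MarkedIdeal.transform_ideal, ← controlledTransform_morphismRestrict,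
      ← controlledTransform_morphismRestrict, hmult,
      comap_controlledTransform_of_flat (s := ε.hom) (π := B ∣_ U) (π' := π ∣_ V) (e₁.inv ≫ e₂.hom) hsq, hC', hI']
  have hx₀V : x₀ ∈ V := by
    rw [← hφ, ← he₁ι, Scheme.Hom.comp_apply]
    exact (e₁.hom y).2
  have hwV : ∀ w : {w : W // π w = x₀}, w.1 ∈ π ⁻¹ᵁ V := fun w => by
    change π w.1 ∈ V
    rw [w.2]
    exact hx₀V
  have he₁y : e₁.inv (e₁.hom y) = y := by
    rw [← Scheme.Hom.comp_apply, Iso.hom_inv_id]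
    rfl
  -- the transport map
  refine ⟨fun w => (B ⁻¹ᵁ U).ι (ε.hom ⟨w.1, hwV w⟩), fun w w' hww => ?_, fun w => ⟨?_, fun hwc => ?_, ?_⟩⟩
  · -- injectivity
    have h1 := (B ⁻¹ᵁ U).ι.isOpenEmbedding.injective hww
    have h2 := ε.hom.isOpenEmbedding.injective h1
    have h3 := Subtype.ext_iff.mp h2
    exact Subtype.ext h3
  · -- over `ξ`
    have hπwt : (π ∣_ V) ⟨w.1, hwV w⟩ = e₁.hom y := by
      apply Subtype.ext
      rw [morphismRestrict_base_coe]
      change π w.1 = ((e₁.hom ≫ V.ι) y : Z)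
      rw [he₁ι, hφ, w.2]
    change B ((B ⁻¹ᵁ U).ι (ε.hom ⟨w.1, hwV w⟩)) = ξ 4 K
    rw [← ι_morphismRestrict_apply, ← Scheme.Hom.comp_apply ε.hom (B ∣_ U), hsq, Scheme.Hom.comp_apply,
      Scheme.Hom.comp_apply, hπwt, he₁y, ← Scheme.Hom.comp_apply, he₂ι, hψ]
  · -- closed points go to closed points
    have hwt_closed : IsClosed ({(⟨w.1, hwV w⟩ : (π ⁻¹ᵁ V : Scheme.{0}))} : Set (π ⁻¹ᵁ V : Scheme.{0})) :=
      isClosed_singleton_of_isOpenImmersion_eq (π ⁻¹ᵁ V).ι ⟨w.1, hwV w⟩ hwc rfl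
    have hεwt_closed : IsClosed ({ε.hom ⟨w.1, hwV w⟩} : Set (B ⁻¹ᵁ U : Scheme.{0})) := by
      have h : (ε.inv : (B ⁻¹ᵁ U : Scheme.{0}) → (π ⁻¹ᵁ V : Scheme.{0})) ⁻¹' {⟨w.1, hwV w⟩} =
          {ε.hom ⟨w.1, hwV w⟩} := by
        ext z
        simp only [Set.mem_preimage, Set.mem_singleton_iff]
        constructor
        · intro hz
          rw [← hz, ← Scheme.Hom.comp_apply, Iso.inv_hom_id]
          rfl
        · intro hz
          rw [hz, ← Scheme.Hom.comp_apply, Iso.hom_inv_id]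
          rfl
      rw [← h]
      exact hwt_closed.preimage ε.inv.continuous
    apply isClosed_singleton_of_isLocallyClosed_singleton
    rw [← Set.image_singleton]
    exact hεwt_closed.isLocallyClosed.image (B ⁻¹ᵁ U).ι.isOpenEmbedding.isInducing
      (B ⁻¹ᵁ U).ι.isOpenEmbedding.isOpen_range.isLocallyClosed
  · -- orders
    have hιwt : (π ⁻¹ᵁ V).ι ⟨w.1, hwV w⟩ = w.1 := rfl
    conv_rhs => rw [← hιwt, ← idealOrder_comap_of_isOpenImmersion (π ⁻¹ᵁ V).ι, ← hKEY,
      idealOrder_comap_of_isOpenImmersion ε.hom, idealOrder_comap_of_isOpenImmersion (B ⁻¹ᵁ U).ι]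

/-- **One-step finiteness of the MODEL bounds the points over `x₀`.** Under the ZIGZAG INVARIANT at `(Z, M, x₀)` with
state `s` and for ANY blowing up `π` of `x₀`: if the chosen blowing up of `𝔸⁵_K` at the origin carries only finitely many
closed points of order `≥ p` of the transform of `(z^p + s.F)·𝒪` over the origin, then `W` carries only finitely many
closed points of order `≥ p` of `M.transform π 𝓘_{x₀}` over `x₀`. [cite: GortzWedhorn2020, Prop. 13.91]
[cite: BierstoneGrigorievMilmanWlodarczyk2011, Lemma 8.0.3 (2)] -/
theorem finite_closedOver_of_zigzag [IsLocallyNoetherian Z] (φ : Y ⟶ Z) [IsOpenImmersion φ] (ψ : Y ⟶ P 4 K)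
    [IsOpenImmersion ψ] (y : Y) (hx₀ : IsClosed ({x₀} : Set Z)) (hφ : φ y = x₀) (hψ : ψ y = ξ 4 K)
    (M : MarkedIdeal Z) (hmult : M.mult = p) (s : State K) (hM : M.ideal.comap φ = (hypSheaf p s.F).comap ψ)
    (hπ : IsBlowup π (Scheme.IdealSheafData.vanishingIdeal (⟨{x₀}, hx₀⟩ : Closeds Z)))
    (hfin : {w' : blowup (Scheme.IdealSheafData.vanishingIdeal (AffinePointBlowup.C₀ 4 K)) |
        IsClosed ({w'} : Set (blowup (Scheme.IdealSheafData.vanishingIdeal (AffinePointBlowup.C₀ 4 K)))) ∧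
        blowup.π (Scheme.IdealSheafData.vanishingIdeal (AffinePointBlowup.C₀ 4 K)) w' = ξ 4 K ∧
        (p : ℕ∞) ≤ idealOrder ((⟨hypSheaf p s.F, [], p⟩ : MarkedIdeal (P 4 K)).transform
          (blowup.π (Scheme.IdealSheafData.vanishingIdeal (AffinePointBlowup.C₀ 4 K)))
          (Scheme.IdealSheafData.vanishingIdeal (AffinePointBlowup.C₀ 4 K))).ideal w'}.Finite) :
    {w : W | IsClosed ({w} : Set W) ∧ π w = x₀ ∧ (p : ℕ∞) ≤ idealOrder
      (M.transform π (Scheme.IdealSheafData.vanishingIdeal (⟨{x₀}, hx₀⟩ : Closeds Z))).ideal w}.Finite := by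
  obtain ⟨f, hf, hfw⟩ := exists_pointTransport_of_zigzag φ ψ y hx₀ hφ hψ M hmult s hM hπ
  set S₀ := {w' : blowup (Scheme.IdealSheafData.vanishingIdeal (AffinePointBlowup.C₀ 4 K)) |
        IsClosed ({w'} : Set (blowup (Scheme.IdealSheafData.vanishingIdeal (AffinePointBlowup.C₀ 4 K)))) ∧
        blowup.π (Scheme.IdealSheafData.vanishingIdeal (AffinePointBlowup.C₀ 4 K)) w' = ξ 4 K ∧
        (p : ℕ∞) ≤ idealOrder ((⟨hypSheaf p s.F, [], p⟩ : MarkedIdeal (P 4 K)).transform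
          (blowup.π (Scheme.IdealSheafData.vanishingIdeal (AffinePointBlowup.C₀ 4 K)))
          (Scheme.IdealSheafData.vanishingIdeal (AffinePointBlowup.C₀ 4 K))).ideal w'} with hS₀
  set S := {w : W | IsClosed ({w} : Set W) ∧ π w = x₀ ∧ (p : ℕ∞) ≤ idealOrder
      (M.transform π (Scheme.IdealSheafData.vanishingIdeal (⟨{x₀}, hx₀⟩ : Closeds Z))).ideal w} with hS
  haveI : Finite S₀ := hfin.to_subtype
  let g : S → S₀ := fun w =>
    ⟨f ⟨w.1, w.2.2.1⟩, (hfw ⟨w.1, w.2.2.1⟩).2.1 w.2.1, (hfw ⟨w.1, w.2.2.1⟩).1,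
      by rw [(hfw ⟨w.1, w.2.2.1⟩).2.2]; exact w.2.2.2⟩
  have hg : Function.Injective g := by
    intro w w' hww
    apply Subtype.ext
    have h1 : f ⟨w.1, w.2.2.1⟩ = f ⟨w'.1, w'.2.2.1⟩ := congrArg Subtype.val hww
    have h2 := Subtype.ext_iff.mp (hf h1)
    exact h2
  exact Set.finite_coe_iff.mp (Finite.of_injective g hg)

end Transport

end Equimultiple

end Summit.ResolutionOfSingularities.ResolutionOfSingularities.Theorems.PIDim4

end
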